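import Summits.QuantumFields.BalabanUV.Beta.CombRemainderParityAllScaled

/-!
# `BalabanUV.Beta.D1LiteralLagrangianRoot` — binder row D1, **THE (III″) LITERAL's ROOT: `D1Drift` FOR THE B12 (2.12) ONE-LOOP LITERAL WITH THE Λ GROUP AT
# THE WEIGHTS THE GENUINE (0.4) FUNCTIONAL HAS BY VALUE — pin `Lc⁸∕2`, mixed table `(Lc¹²∕4) • symMixFFAt` — from the two unit locks, `D1Tel` and `D1Rep`**
# (the DISPLAY corollary of the κ-generic root `CombRemainderParityAllScaled.d1Drift_JsB12CombShSym_an1TablesS2w_pinned_of_locks_D1Tel_D1Rep` at `w = Lc¹²∕4`;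
# an2 SPEC (III″) v1.2 `HOME/b2b-balaban-beta-an2/gen56/III2-SPEC-g56.v1_2.md` db3f1dcee2ceae52 §5's DISPLAY name; W-3 l.63100 (D6))

THE OBJECT (SPEC §1): (III″) := the level-0 one-loop polarization (B12 (1.20)–(1.22)) of `U ↦ log Z^{(k)}(U)` with `Z^{(k)}` EXACTLY B12 (2.12)'s Gaussian — the
LAGRANGIAN Hessian at the constrained minimiser ([13] (3.156): Wilson ∕ averaging Hessians PLUS the multiplier term), on the comb slice, no linear term; the SAME
tables ∕ kernel ∕ unit ∕ neutral sector as the typed (III′) literal of record (`JsB12CombShSym`, `GcombSh`, `cE = Lc⁴`, `cVH = −Lc⁸∕2`, `cE₂ = Lc⁸`, `cB = −Lc¹²∕4`,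
`(8N²)⁻¹•wsym22 N`, u = 32) with its Λ GROUP (first-order Λ stencil, multiplier table, mixed field–multiplier table, mixed remainders) at the common weight
`w = Lc¹²∕4`: pin `w·cΛ₀ = Lc⁸∕2 = −cVH` (`cΛ₀ = 2∕Lc⁴`, the lock of record), mixed table `(Lc¹²∕4) • symMixFFAt ρ_c Lc` (RULINGS R-D1-g56-3∕-4, HOME/CLAIMS.log
l.62817 ∕ l.62966; the cause by type: leaf-01 g41 N-1∕A-2 l.62785∕l.62821 — the factor lives in the absolute pin; Q-an2-g56-1 closed by the tree theorem
`LagrangeFoldComb.dM_SpureRecOf_M1Of_eq_vertexOfK_SrecOf_comb`).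
THE BY-VALUE RECORD (SPEC §2‴ + §3; informational float64, zero weight in the kernel): the LEVEL-0 S2 read-out of this literal equals the genuine (0.4) one-step
one-loop coefficient β⁰_T^{(0.4)}(3; n_s) WORD BY WORD on coarse tori of side n_s = 3 (planes (0,1), (0,2), (2,3)) and n_s = 4 (plane (0,1)) — two independent
programs (Engine C `ttrl/balaban-calc/prestab/atk/ATK.md` sha256 ea54d781…; d1-p2 g29 `R3-WORDS.md` e1177d985ec25326) and three readers (an2 RCPT-4∕R5 l.63155, leaf-01 g42
R-2 l.63194 scorecard `ATK-READOUT-g42.md` a11cd94393227e04, leaf-03 g49∕g50): AT-3 32·S2(0,1) = 6.144614851414 (genuine 6.1446148514181, Δ −4.1e−12) at n_s = 3 and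
2.646166692335 (2.6461666923359, Δ −6.9e−13) at n_s = 4; a THIRD size n_s = 6 by d1-p2 g29 (P5) vs leaf-03 g49's sharp (P5″) prediction from
Engine C's p = 6 fold at κ* (tad C −1.750612231 measured = predicted to 2.6e−10; HOME/CLAIMS.log l.63251); AT-2 six planes equal to 1.46e−13; SPLIT D_slice = −2.4e−14; AT-0 orders 0∕1 exact (order-1 ff clause with Δ₁
assembled once, both spellings ≤ 2.5e−13); AT-4 u = 32; AT-1 (chart swap) informational; AT-0 order 2 NOT RUN.  SCOPE OF THE RECORD (leaf-01 R-2 (γ)): every one of these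
numbers is a statement about the ONE-STEP (level-0) member on tori of side 3, 4 (and 6 for the tadpoles); the level weights at j ≥ 1 (`wΛ_j`, `wM1_j`, `wM2_j`, …) through which this ONE `w`
acts at every level are the typed ones of the record — by value unexamined; `D1Drift` quantifies over all levels.
WHAT THIS FILE IS: ONE corollary — the κ-generic root (this lineage's P5c over leaf-04 g33's S2w…Nw chain, leaf-03 g50's slotted remainder objects P1–P4, an2 g56's
`SymLamGroupScaling`, leaf-04's record `SymTablesAn1S2Weighted`) at `(cΛ, w) := (2∕Lc⁴, Lc¹²∕4)`, the pin `w·cΛ = Lc⁸∕2` computed (`field_simp`), the lock `(2∕Lc⁴)·Lc⁴ = 2`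
discharged; NO new hypothesis; `D1Tel`∕`D1Rep` of THIS literal and the printed B5 facts `h12`∕`h126` stay displayed VERBATIM as in ROOT M‴.
WHAT THIS IS NOT: NOT D1 (`D1Tel` — road FP — and `D1Rep` — road BF-x — are HYPOTHESES); 0∕4 row-D1 binders discharged by it; nothing of Bałaban's asserted, valued or
discharged; the by-value record is CITED, not used; ROOT M‴ p325680 and the root of record untouched; the (III′) literal's VALUE stays quarantined (R5 (5-2)); (J1) ONE
OPEN ROW — dormant by value; (K) NOT closed; NEVER «G-an2-4 closed», NOT `BetaPertH`, NOT continuum, NOT Clay.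

HONEST DEPENDENCY (page 1, mandatory): continuum YM on T⁴ ⇐ BetaPertH ∧ nine spine estimates (0/9 proved); BetaPertH ⇐ (D1) ∧ (D4) ∧ CAP+tail;
G-an2-4 gates asym, D1 and NE2/3/4.  DERIVED cell leaf ([folklore] BY NAME; β sub-cell, D1 formalisation swarm leaf prover 01 (`b2b-balaban-beta-d1-formalise-leaf-01`
gen 42), 2026-08-25 (v1.1: v1 + the n_s = 6 sentence); INTENT I-leaf01-g42-2 «ROOT-κ DISPLAY» l.63217; the row OWNER's (D6) name); no statement of Bałaban's papers, no `[cite:]`, no `Prop` fact,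
no `def`; no existing file touched.
-/

noncomputable section

open Finset
open scoped BigOperators
open Literature.MathematicalPhysics.QuantumFieldTheory
open Literature.MathematicalPhysics.QuantumFieldTheory.Balaban1983to89
open Literature.MathematicalPhysics.QuantumFieldTheory.Balaban1983to89.Beta
open Literature.MathematicalPhysics.QuantumFieldTheory.Balaban1983to89.Beta.VectorTailsLoc (fam kfam)
open Literature.MathematicalPhysics.QuantumFieldTheory.Balaban1983to89.Beta.VectorLegVolumeAdapter (MvE)
open OneStepResolventKernel (JetData)
open OneStepKernelFamily (D1Tel D1Rep D1Drift)
open Summit.QuantumFields.BalabanUV.Beta.CombChartJointEnd (JsB12CombShSym)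
open Summit.QuantumFields.BalabanUV.Beta.SymTablesAn1S2Weighted (symTablesAn1S2w)
open Summit.QuantumFields.BalabanUV.Beta.CombRemainderParityAllScaled (d1Drift_JsB12CombShSym_an1TablesS2w_pinned_of_locks_D1Tel_D1Rep)

namespace Summit.QuantumFields.BalabanUV.Beta.D1LiteralLagrangianRoot

variable {Lc : ℕ} [NeZero Lc]

/-- [folklore] **THE (III″) PINS ARE ONE POINT OF THE κ-FAMILY**: at the lock of record `cΛ₀ = 2∕Lc⁴` and the group weight `w = Lc¹²∕4`, the pin is
`w·cΛ₀ = Lc⁸∕2` (= −cVH) — leaf-01 g41 A-2's `(|cΛ′|, w′) = (|cVH|, |cB|)`, as a two-line identity. -/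
theorem lagrangian_pin : ((Lc : ℝ) ^ 12 / 4) * (2 / (Lc : ℝ) ^ 4) = (Lc : ℝ) ^ 8 / 2 := by
  have hL : (Lc : ℝ) ≠ 0 := Nat.cast_ne_zero.2 (NeZero.ne Lc)
  field_simp
  ring

/-- [folklore] The lock of record holds at `cΛ₀ = 2∕Lc⁴` (trivially). -/
theorem lagrangian_lock : (2 / (Lc : ℝ) ^ 4) * (Lc : ℝ) ^ 4 = 2 := by
  have hL : (Lc : ℝ) ≠ 0 := Nat.cast_ne_zero.2 (NeZero.ne Lc)
  field_simp

/-- **ROW D1 — THE (III″) LITERAL's ROOT (DISPLAY COROLLARY OF THE κ-GENERIC ROOT AT `w = Lc¹²∕4`):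
`D1Drift Lc (JsB12CombShSym hLc N (symTablesAn1S2w 3 Lc (Lc⁸∕2) (Lc¹²∕4)) (Lc⁸∕2) cB) Nc μ ν ⟸ hcB ∧ D1Tel ∧ D1Rep`** (+ ROOT M‴'s own binders VERBATIM: printed B5
facts `h12`∕`h126`, window, `μ ≠ ν`, `Nc ≠ 0`, `2 ≤ Lc`, `Odd Lc`, `2 ≤ N`).  This is the B12 (2.12) one-loop literal in the comb chart with an1's closed SYM table
record and its multiplier ∕ Λ group at the weights the genuine (0.4) functional has BY VALUE — pin `Lc⁸∕2` on the first-order Λ stencil and the multiplier table,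
`Lc¹²∕4` on the mixed field–multiplier table (an2 RULINGS R-D1-g56-3∕-4; SPEC (III″) v1.2 §2″∕§2‴∕§3; Engine C ATK deposit ea54d781…: every registered acceptance row
MET at level 0 on tori n_s = 3, 4 — CITED, not used).  Proof: `CombRemainderParityAllScaled.d1Drift_JsB12CombShSym_an1TablesS2w_pinned_of_locks_D1Tel_D1Rep` at
`(cΛ, w) := (2∕Lc⁴, Lc¹²∕4)` with `lagrangian_lock`, the pin rewritten by `lagrangian_pin`.  HONEST: composition by name; `D1Tel` (road FP) and `D1Rep` (road BF-x)
are HYPOTHESES — NOT D1; nothing of Bałaban's asserted, valued or discharged; ROOT M‴ p325680 and the root of record untouched; NEVER «G-an2-4 closed», NOT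
`BetaPertH`, NOT continuum, NOT Clay. -/
theorem d1Drift_JsB12CombShSym_lagrangianLiteral_of_locks_D1Tel_D1Rep (hLc : Odd Lc) (hL2 : 2 ≤ Lc) {N : ℕ} (hN : 2 ≤ N) (cB : ℝ)
    -- the second unit lock of an1's TABLE-FIT tier 2 (the first, `cΛ₀·Lc⁴ = 2`, is discharged at `cΛ₀ = 2∕Lc⁴`)
    (hcB : cB = -((Lc : ℝ) ^ 12 / 4))
    -- the route theorem's own binders, verbatim
    (a : ℝ) (ha : 0 < a)
    (h12 : B5.Prop12Printed (fam (fun i : ℕ+ × ℕ => ((i.1 : ℕ+) : ℕ)) (fun i => i.1.pos) MvE a ha))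
    (h126 : B5.Kernel126_127Printed (kfam (fun i : ℕ+ × ℕ => ((i.1 : ℕ+) : ℕ)) MvE))
    {L : Type*} {SL : Finset L} (hSL : SL.Nonempty) (k : L → Fin 4) {μ ν : Fin 4} (hμν : μ ≠ ν) {Nc : ℝ} (hNc : Nc ≠ 0)
    (Jc : ∀ m : ℕ, JetData 3 (Lc ^ m))
    (htel : D1Tel Lc (JsB12CombShSym hLc N (symTablesAn1S2w 3 Lc ((Lc : ℝ) ^ 8 / 2) ((Lc : ℝ) ^ 12 / 4)) ((Lc : ℝ) ^ 8 / 2) cB) Jc)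
    {cc : ℝ} {Mw' : ℕ → ℕ} (hc : 1 ≤ cc) (hMwin : ∀ L : ℕ, 2 ≤ L → 1 ≤ Mw' L ∧ (L : ℝ) ≤ cc * Mw' L) (hML : ∀ L : ℕ, 2 ≤ L → Mw' L ≤ L)
    (hrep : D1Rep Lc Jc Nc μ ν a SL k) :
    D1Drift Lc (JsB12CombShSym hLc N (symTablesAn1S2w 3 Lc ((Lc : ℝ) ^ 8 / 2) ((Lc : ℝ) ^ 12 / 4)) ((Lc : ℝ) ^ 8 / 2) cB) Nc μ ν := by
  have key := d1Drift_JsB12CombShSym_an1TablesS2w_pinned_of_locks_D1Tel_D1Rep (Lc := Lc) hLc hL2 hN (2 / (Lc : ℝ) ^ 4) ((Lc : ℝ) ^ 12 / 4) cB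
    (lagrangian_lock (Lc := Lc)) hcB a ha h12 h126 hSL k hμν hNc Jc
  rw [lagrangian_pin (Lc := Lc)] at key
  exact key htel hc hMwin hML hrep

end Summit.QuantumFields.BalabanUV.Beta.D1LiteralLagrangianRoot

end
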